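import Summits.QuantumAdvantage.AdviceFreeQNC0.WalkGapNaming
import HarnessLib

/-!
# Cell qa-qnc0 (odd primes `p ≥ 5`, the DENSE core): `FeatOfVPE p` — the feature rung from VISIT-PARITY ELIMINATION

Planner qa-qnc0-p2 g14, ROUND-14 §4 / `line14/Sketch14p2.lean` §7 (statements `visitCountIn`, `VisitParityElimF`, `WalkHardFFeat`,
`FeatOfVPE` VERBATIM — "the dense core, distilled").  PROVED here, for every prime `p`:

* **`ringWinU_fixed`** — a FIXED firing set wins α's u-walk game at `u` iff the PARITY OF VISITS of the hidden walk
  `h ↦ h + |u_<h| (mod 3)`, at the fired times, to the state `2c + 2|u|` differs from the parity of the number of fired cuts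
  (the level-set form of `avoidNormalForm`, ROUND-14 §4(a));
* `hasDegF_levelSet` — the level set of `K` features of degree `≤ D` has degree `≤ K·D` (pattern-degree lemma);
* **`featOfVPE : FeatOfVPE p`** — `VisitParityElimF p → WalkHardFFeat p` with `θ = 1 − η/2`: on each of the `2^K·3` cells
  `{φ = v} ∩ {|u| ≡ t}` the strategy is the fixed firing set `Y_v` and its losses are the inputs with one prescribed visit parity;
  VPE with `δ = η/(6·2^K)` bounds them below cell by cell, and the cells partition the cube.

So the first DENSE rung (`WalkHardFFeat p`: finitely many polylog-degree `𝔽_p` features, arbitrarily many shots) is EQUIVALENT in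
substance to the elimination statement VPE — the honest residual of route `OddPrimeWalk` (`DenseResidualOdd`) in its sharpest typed form.
WHAT THIS IS NOT: VPE (`VisitParityElimF p`) is OPEN (CDH-adjacent, ROUND-14 §4(b)); nothing unconditional about dense strategies is
proved here; separation NOT moved.
-/

noncomputable section

namespace Summit.QuantumAdvantage.AdviceFreeQNC0

open Classical
open Finset
open Literature.Computability.MetaComplexity Literature.Computability.MetaComplexity.Smolensky

variable {n : ℕ}

/-! ### Statements (planner qa-qnc0-p2 Sketch14p2 §7, verbatim) -/

/-- Number of times `h ∈ Y` at which the hidden walk `h + |z_<h|` (started at `κ`) sits in state `x (mod 3)`.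
(Sketch14p2 §7, verbatim.) -/
def visitCountIn (Y : Finset ℕ) (κ x : ℕ) (z : Fin n → Bool) : ℕ :=
  (Y.filter fun h => (κ + h + wtPrefix z h) % 3 = x % 3).card

/-- **`VisitParityElimF p`** (VPE; OPEN, research): inside a residue class `|z| ≡ t (mod 3)`, no polylog-degree `𝔽_p` set
selects one value of the VISIT PARITY of the hidden walk at a prescribed set of times `Y` beyond the fraction `1 − η`,
up to an additive error `δ·2^L` (any `δ > 0`, `L ≥ L₀(C, δ)`).  For a fixed firing set `Y` the u-walk game is won iff
`visitCountIn Y 0 (2c + 2|u|) u ≢ |Y| (mod 2)` (from `avoidNormalForm`), so VPE is exactly «a low-degree level set cannot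
select the inputs on which a FIXED dense strategy wins»; a proof for fan-in-2 features would already be a CDH-type statement
with a structured (walk) inner layer. (Sketch14p2 §7, verbatim; OPEN.) -/
def VisitParityElimF (p : ℕ) [Fact p.Prime] : Prop :=
  ∃ η : ℝ, 0 < η ∧ ∀ C : ℕ, ∀ δ : ℝ, 0 < δ → ∃ L₀ : ℕ, ∀ L ≥ L₀, ∀ (Y : Finset ℕ) (κ x t : ℕ) (ε : Bool)
    (g : (Fin L → Bool) → Bool), HasDegF p g ((Nat.log 2 L) ^ C) →
      η * ((univ.filter fun z : Fin L → Bool => g z = true ∧ wt z % 3 = t % 3).card : ℝ)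
        ≤ ((univ.filter fun z : Fin L → Bool => g z = true ∧ wt z % 3 = t % 3 ∧
              decide (visitCountIn Y κ x z % 2 = 0) = ε).card : ℝ) + δ * (2 : ℝ) ^ L

/-- **`WalkHardFFeat p`** (OPEN; the first DENSE rung): a strategy reading the input only through a CONSTANT number `K` of Boolean
FEATURES of `𝔽_p`-degree ≤ `(log₂ n)^C` (so `n₀` may depend on `K`; `θ` does not), firing ARBITRARILY MANY cuts, wins at most `θ·2ⁿ`.
`WalkHardFFeat p ⟸ VisitParityElimF p`: on each of the `2^K` level sets `{φ = v}` the strategy is a FIXED firing set `Y_v`, the level-set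
indicator has degree ≤ `K·(log₂ n)^C`, and VPE with `δ := η/(6·2^K)` summed over the `3·2^K` level-set/residue pairs gives `#LOSE ≥ (η/2)·2ⁿ`.
(Growing `K` would need VPE with a quantitatively small error `δ(L) → 0`, e.g. `δ ≤ (log₂ L)^{−C}`.) (Sketch14p2 §7, verbatim.)
PROVED from VPE: `featOfVPE`. -/
def WalkHardFFeat (p : ℕ) [Fact p.Prime] : Prop :=
  ∃ θ : ℝ, θ < 1 ∧ ∀ C K : ℕ, ∃ n₀ : ℕ, ∀ n ≥ n₀, ∀ c : ℕ, ∀ f : Fin K → (Fin n → Bool) → Bool,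
    ∀ tab : Fin (n + 1) → (Fin K → Bool) → Bool,
    (∀ j, HasDegF p (f j) ((Nat.log 2 n) ^ C)) →
      ((univ.filter fun u : Fin n → Bool =>
          ringWinU c (fun g u => tab g (fun j => f j u)) u = true).card : ℝ) ≤ θ * (2 : ℝ) ^ n

/-- `FeatOfVPE p` (Sketch14p2 §7, verbatim): the feature rung from visit-parity elimination. PROVED: `featOfVPE`. -/
def FeatOfVPE (p : ℕ) [Fact p.Prime] : Prop := VisitParityElimF p → WalkHardFFeat p

/-! ### A fixed firing set wins iff the visit parity is off -/

/-- The firing set of a table pattern, as a set of natural numbers. -/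
def firedSet (tab : Fin (n + 1) → Bool) : Finset ℕ :=
  (univ.filter fun g : Fin (n + 1) => tab g = true).image Fin.val

/-- The fired set has as many elements as fired cuts. -/
theorem card_firedSet (tab : Fin (n + 1) → Bool) :
    (firedSet tab).card = (univ.filter fun g : Fin (n + 1) => tab g = true).card := by
  unfold firedSet
  exact Finset.card_image_of_injective _ Fin.val_injective

/-- The number of fired cuts whose hidden label hits the charge: the visit count of the walk in state `2c + 2|u|`. -/
theorem card_fired_hit (c : ℕ) (tab : Fin (n + 1) → Bool) (u : Fin n → Bool) :
    (univ.filter fun g : Fin (n + 1) => tab g = true ∧ (c + g.val + walkExp u g.val) % 3 = 0).card =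
      visitCountIn (firedSet tab) 0 (2 * c + 2 * wt u) u := by
  unfold visitCountIn firedSet
  rw [Finset.filter_image, Finset.card_image_of_injective _ Fin.val_injective, Finset.filter_filter]
  congr 1
  refine Finset.filter_congr fun g _ => ?_
  unfold walkExp
  constructor
  · rintro ⟨h1, h2⟩; exact ⟨h1, by omega⟩
  · rintro ⟨h1, h2⟩; exact ⟨h1, by omega⟩

/-- **A FIXED firing set wins iff its visit parity differs from the parity of its size.** -/
theorem ringWinU_fixed (c : ℕ) (tab : Fin (n + 1) → Bool) (u : Fin n → Bool) :
    ringWinU c (fun g _ => tab g) u =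
      decide (visitCountIn (firedSet tab) 0 (2 * c + 2 * wt u) u % 2 ≠ (firedSet tab).card % 2) := by
  unfold ringWinU
  have hsplit := Finset.card_filter_add_card_filter_not
    (s := univ.filter fun g : Fin (n + 1) => tab g = true)
    (fun g : Fin (n + 1) => (c + g.val + walkExp u g.val) % 3 ≠ 0)
  rw [Finset.filter_filter, Finset.filter_filter] at hsplit
  have hhit : (univ.filter fun g : Fin (n + 1) => tab g = true ∧ ¬ (c + g.val + walkExp u g.val) % 3 ≠ 0).card =
      visitCountIn (firedSet tab) 0 (2 * c + 2 * wt u) u := by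
    rw [← card_fired_hit c tab u]
    congr 1
    exact Finset.filter_congr fun g _ => by simp
  rw [hhit, ← card_firedSet tab] at hsplit
  have hle : visitCountIn (firedSet tab) 0 (2 * c + 2 * wt u) u ≤ (firedSet tab).card := by
    unfold visitCountIn; exact Finset.card_filter_le _ _
  by_cases hw : (univ.filter fun g : Fin (n + 1) => tab g = true ∧ (c + g.val + walkExp u g.val) % 3 ≠ 0).card % 2 = 1
  · rw [decide_eq_true hw, decide_eq_true]; omega
  · rw [decide_eq_false hw, decide_eq_false]; omega

/-- The visit count depends on the target state only modulo `3`. -/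
theorem visitCountIn_mod (Y : Finset ℕ) (κ x x' : ℕ) (z : Fin n → Bool) (h : x % 3 = x' % 3) :
    visitCountIn Y κ x z = visitCountIn Y κ x' z := by
  unfold visitCountIn; rw [h]

/-! ### The feature rung from VPE -/

/-- The level set of a feature vector has `𝔽_p`-degree `≤ K·D`. -/
theorem hasDegF_levelSet {p : ℕ} [Fact p.Prime] {K D : ℕ} (f : Fin K → (Fin n → Bool) → Bool)
    (hdeg : ∀ j, HasDegF p (f j) D) (v : Fin K → Bool) :
    HasDegF p (fun u => decide ((fun j => f j u) = v)) (K * D) := by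
  unfold HasDegF
  have h := GapFibre.ind_mem_lowDeg_of_pattern (F := ZMod p) (L := n) (D := D) (univ : Finset (Fin K))
    (fun j u => f j u) (fun j _ => hdeg j) (fun u => decide ((fun j => f j u) = v))
    (fun z z' hzz' => by
      have : (fun j => f j z) = fun j => f j z' := funext fun j => hzz' j (mem_univ j)
      simp only [this])
  rw [Finset.card_univ, Fintype.card_fin] at h
  refine (congrArg (· ∈ lowDeg (ZMod p) n (K * D)) ?_).mpr h
  funext u
  simp only [decide_eq_true_eq]

/-- Double counting over the `2^K · 3` cells `{φ = v} ∩ {|u| ≡ t}`. -/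
theorem card_eq_sum_cells {K : ℕ} (φ : (Fin n → Bool) → (Fin K → Bool)) (S : Finset (Fin n → Bool)) :
    (S.card : ℝ) =
      ∑ v : Fin K → Bool, ∑ t ∈ Finset.range 3,
        ((S.filter fun u : Fin n → Bool => φ u = v ∧ wt u % 3 = t).card : ℝ) := by
  have h := Finset.card_eq_sum_card_fiberwise (f := fun u : Fin n → Bool => (φ u, wt u % 3))
    (s := S) (t := (univ : Finset (Fin K → Bool)) ×ˢ Finset.range 3)
    (fun u _ => Finset.mem_coe.2 (Finset.mem_product.2 ⟨mem_univ _, Finset.mem_range.2 (Nat.mod_lt _ (by norm_num))⟩))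
  rw [h, Nat.cast_sum, Finset.sum_product]
  refine Finset.sum_congr rfl fun v _ => ?_
  refine Finset.sum_congr rfl fun t _ => ?_
  congr 2
  ext u
  simp only [mem_filter, Prod.ext_iff]

/-- **`FeatOfVPE p` — PROVED for every prime `p`**: visit-parity elimination implies the feature rung, `θ = 1 − η/2`. -/
theorem featOfVPE (p : ℕ) [Fact p.Prime] : FeatOfVPE p := by
  rintro ⟨η, hη, hV⟩
  refine ⟨1 - η / 2, by linarith, fun C K => ?_⟩
  have hδ : (0 : ℝ) < η / (6 * 2 ^ K) := by positivity
  obtain ⟨L₀, hL₀⟩ := hV (C + 1) (η / (6 * 2 ^ K)) hδ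
  refine ⟨max L₀ (2 ^ (K + 1)), fun n hn c f tab hdeg => ?_⟩
  have hnL : L₀ ≤ n := le_trans (le_max_left _ _) hn
  have hlogK : K + 1 ≤ Nat.log 2 n := Nat.le_log_of_pow_le (by norm_num) (le_trans (le_max_right _ _) hn)
  have h2n : (0 : ℝ) < (2 : ℝ) ^ n := by positivity
  -- the strategy, its feature map and level sets
  set y : Fin (n + 1) → (Fin n → Bool) → Bool := fun g u => tab g (fun j => f j u) with hy
  set φ : (Fin n → Bool) → (Fin K → Bool) := fun u j => f j u with hφ
  have hdegv : ∀ v : Fin K → Bool, HasDegF p (fun u => decide (φ u = v)) ((Nat.log 2 n) ^ (C + 1)) := by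
    intro v
    have h := hasDegF_levelSet f hdeg v
    unfold HasDegF at h ⊢
    refine lowDeg_mono ?_ h
    calc K * (Nat.log 2 n) ^ C ≤ Nat.log 2 n * (Nat.log 2 n) ^ C := Nat.mul_le_mul_right _ (by omega)
      _ = (Nat.log 2 n) ^ (C + 1) := by ring
  -- on the cell `{φ = v, |u| ≡ t}` the game is the FIXED firing set `tab · v` and a loss is a visit-parity value
  have hcell : ∀ (v : Fin K → Bool) (t : ℕ),
      (univ.filter fun u : Fin n → Bool => decide (φ u = v) = true ∧ wt u % 3 = t % 3 ∧
        decide (visitCountIn (firedSet fun g => tab g v) 0 (2 * c + 2 * t) u % 2 = 0) =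
          decide ((firedSet fun g => tab g v).card % 2 = 0)).card ≤
      (univ.filter fun u : Fin n → Bool => ringWinU c y u = false ∧ φ u = v ∧ wt u % 3 = t % 3).card := by
    intro v t
    refine Finset.card_le_card fun u hu => ?_
    rw [mem_filter] at hu ⊢
    obtain ⟨_, hv, ht, hpar⟩ := hu
    rw [decide_eq_true_eq] at hv
    refine ⟨mem_univ _, ?_, hv, ht⟩
    have hfix : ringWinU c y u = ringWinU c (fun g _ => tab g v) u := by
      unfold ringWinU
      have : (univ.filter fun g : Fin (n + 1) => y g u = true ∧ (c + g.val + walkExp u g.val) % 3 ≠ 0) =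
          univ.filter fun g : Fin (n + 1) => tab g v = true ∧ (c + g.val + walkExp u g.val) % 3 ≠ 0 := by
        refine Finset.filter_congr fun g _ => ?_
        rw [hy]; simp only; rw [show (fun j => f j u) = v from hv]
      rw [this]
    rw [hfix, ringWinU_fixed, visitCountIn_mod _ 0 (2 * c + 2 * wt u) (2 * c + 2 * t) u (by omega)]
    rw [decide_eq_false_iff_not, not_not]
    by_cases h0 : visitCountIn (firedSet fun g => tab g v) 0 (2 * c + 2 * t) u % 2 = 0
    · rw [decide_eq_true h0] at hpar
      have := of_decide_eq_true hpar.symm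
      omega
    · rw [decide_eq_false h0] at hpar
      have h1 : ¬ (firedSet fun g => tab g v).card % 2 = 0 := of_decide_eq_false hpar.symm
      omega
  -- VPE on every cell
  have hvpe : ∀ (v : Fin K → Bool) (t : ℕ),
      η * ((univ.filter fun u : Fin n → Bool => decide (φ u = v) = true ∧ wt u % 3 = t % 3).card : ℝ) ≤
        ((univ.filter fun u : Fin n → Bool => ringWinU c y u = false ∧ φ u = v ∧ wt u % 3 = t % 3).card : ℝ) +
          η / (6 * 2 ^ K) * (2 : ℝ) ^ n := by
    intro v t
    have h := hL₀ n hnL (firedSet fun g => tab g v) 0 (2 * c + 2 * t) t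
      (decide ((firedSet fun g => tab g v).card % 2 = 0)) (fun u => decide (φ u = v)) (hdegv v)
    refine le_trans h ?_
    have := hcell v t
    have hc : ((univ.filter fun u : Fin n → Bool => decide (φ u = v) = true ∧ wt u % 3 = t % 3 ∧
        decide (visitCountIn (firedSet fun g => tab g v) 0 (2 * c + 2 * t) u % 2 = 0) =
          decide ((firedSet fun g => tab g v).card % 2 = 0)).card : ℝ) ≤
        ((univ.filter fun u : Fin n → Bool => ringWinU c y u = false ∧ φ u = v ∧ wt u % 3 = t % 3).card : ℝ) := by
      exact_mod_cast this
    linarith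
  -- summing over the cells
  have hsumAll : ((2 : ℝ) ^ n) = ∑ v : Fin K → Bool, ∑ t ∈ Finset.range 3,
      ((univ.filter fun u : Fin n → Bool => decide (φ u = v) = true ∧ wt u % 3 = t % 3).card : ℝ) := by
    have h := card_eq_sum_cells φ (univ : Finset (Fin n → Bool))
    rw [card_univ, Fintype.card_fun, Fintype.card_bool, Fintype.card_fin] at h
    push_cast at h
    rw [h]
    refine Finset.sum_congr rfl fun v _ => Finset.sum_congr rfl fun t ht => ?_
    rw [Finset.mem_range] at ht
    congr 2
    refine Finset.filter_congr fun u _ => ?_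
    rw [decide_eq_true_eq, Nat.mod_eq_of_lt ht]
  have hsumLose : ((univ.filter fun u : Fin n → Bool => ringWinU c y u = false).card : ℝ) =
      ∑ v : Fin K → Bool, ∑ t ∈ Finset.range 3,
        ((univ.filter fun u : Fin n → Bool => ringWinU c y u = false ∧ φ u = v ∧ wt u % 3 = t % 3).card : ℝ) := by
    rw [card_eq_sum_cells φ (univ.filter fun u : Fin n → Bool => ringWinU c y u = false)]
    refine Finset.sum_congr rfl fun v _ => Finset.sum_congr rfl fun t ht => ?_
    rw [Finset.mem_range] at ht
    rw [Finset.filter_filter, Nat.mod_eq_of_lt ht]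
  have hK : (Fintype.card (Fin K → Bool) : ℝ) = (2 : ℝ) ^ K := by
    rw [Fintype.card_fun, Fintype.card_bool, Fintype.card_fin]; push_cast; ring
  have hloss : η / 2 * (2 : ℝ) ^ n ≤ ((univ.filter fun u : Fin n → Bool => ringWinU c y u = false).card : ℝ) := by
    rw [hsumLose]
    have hstep : ∑ v : Fin K → Bool, ∑ t ∈ Finset.range 3,
        (η * ((univ.filter fun u : Fin n → Bool => decide (φ u = v) = true ∧ wt u % 3 = t % 3).card : ℝ) -
          η / (6 * 2 ^ K) * (2 : ℝ) ^ n) ≤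
        ∑ v : Fin K → Bool, ∑ t ∈ Finset.range 3,
          ((univ.filter fun u : Fin n → Bool => ringWinU c y u = false ∧ φ u = v ∧ wt u % 3 = t % 3).card : ℝ) :=
      Finset.sum_le_sum fun v _ => Finset.sum_le_sum fun t _ => by linarith [hvpe v t]
    refine le_trans (le_of_eq ?_) hstep
    have hexp : ∑ v : Fin K → Bool, ∑ t ∈ Finset.range 3,
        (η * ((univ.filter fun u : Fin n → Bool => decide (φ u = v) = true ∧ wt u % 3 = t % 3).card : ℝ) -
          η / (6 * 2 ^ K) * (2 : ℝ) ^ n) =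
        η * (∑ v : Fin K → Bool, ∑ t ∈ Finset.range 3,
          ((univ.filter fun u : Fin n → Bool => decide (φ u = v) = true ∧ wt u % 3 = t % 3).card : ℝ)) -
          (Fintype.card (Fin K → Bool) : ℝ) * 3 * (η / (6 * 2 ^ K) * (2 : ℝ) ^ n) := by
      simp only [Finset.sum_sub_distrib, Finset.sum_const, Finset.card_range, Finset.card_univ,
        Finset.mul_sum, nsmul_eq_mul]
      push_cast
      ring
    rw [hexp, ← hsumAll, hK]
    field_simp
    ring
  -- WIN = 2^n − LOSE
  have htot : ((univ.filter fun u : Fin n → Bool => ringWinU c y u = true).card : ℝ) +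
      ((univ.filter fun u : Fin n → Bool => ringWinU c y u = false).card : ℝ) = (2 : ℝ) ^ n := by
    have h := Finset.card_filter_add_card_filter_not (s := (univ : Finset (Fin n → Bool)))
      (fun u : Fin n → Bool => ringWinU c y u = true)
    have hneg : (univ.filter fun u : Fin n → Bool => ¬ ringWinU c y u = true) =
        univ.filter fun u : Fin n → Bool => ringWinU c y u = false :=
      Finset.filter_congr fun u _ => by simp
    rw [hneg, card_univ, Fintype.card_fun, Fintype.card_bool, Fintype.card_fin] at h
    exact_mod_cast h
  show ((univ.filter fun u : Fin n → Bool => ringWinU c y u = true).card : ℝ) ≤ (1 - η / 2) * (2 : ℝ) ^ n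
  linarith

end Summit.QuantumAdvantage.AdviceFreeQNC0

end
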